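import Summits.QuantumFields.YangMills.Theorems.AlphaInputsT3ACv3LocalSmallT3Hook
import Summits.QuantumFields.YangMills.Theorems.AlphaInputsT3ACv3DataSchemaL
import HarnessLib

/-!
# `AlphaInputsT3ACv3CoreNonempty` — STRATEGY B for 2′: THE UNCHARGED HALF OF (D6L) FROM ONE DISPLAYED KINEMATIC ROW «a regular, (67)-large profile whose fine plaquettes are
# small near the read regions» (`RegularProfileNearT3`) — lane `pub-balaban3d`, seat alpha-2 (g2)

WHAT (typing-first; HOME `D6-AUDIT-alpha2-g2.md` §4(a)).  The successor's target for the CORE of the localised adapted class, as ONE hypothesis schema: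
`AlphaInputsT3AC.RegularProfileNearT3 F 𝔠 γ hγ hγ1 K` := for every `k ≤ K` and admissible `h ≠ triv` there is a finest-lattice configuration `U ∈ regClassC 𝔊 𝔠 k h ∩ large67Set k h`
whose fine plaquettes within `ℓ¹`-distance `39·L^{i₀}` of every read region `lam42 Ω(h) k i`, `i₀ ≤ i ≤ k`, are `α₀·(L^{i₀})⁻²`-small for some `α₀` in [B7] Prop. 2's window at
`d = 3`, `N = 2` — NODE O's profile (`…ProfileBuild.prof`: `prof_mem_regClassC`, `hLarge_prof`) with its cut-offs shifted outward is the intended witness (the fork of F4 §5/F5a–d;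
collar row (N2)).  PROVED HERE: ★ `adaptedClassT3L_nonempty_of_not_charged` — under that row, `𝒞_L(k, h, W) ≠ ∅` for every UNCHARGED datum `W` (the guarded (42)/r3 clause is
vacuous; the core membership is `localSmallT3_of_plaqSmall_near_reads` + the two class memberships); `core_nonempty_of_regularProfileNear` (the W-independent core).  The CHARGED half
of (D6L) (a regular lift of `W|Ω_k(h)` glued to the profile) is NOT addressed (§4(b) of the memo).
HONEST FRAMING.  Hypothesis schema + plumbing; nothing of [B10]∕[7]∕[4]'s estimates asserted; count-neutral helper toward R3 2′ (`stub_laneRecordsV3`, items 19935∕19936); nothing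
about d = 4, the continuum, or a mass gap.

References: T. Bałaban, Commun. Math. Phys. 102 (1985) 255–275 [Balaban1985UV3] ((42) p.266, (67)–(68) p.273); CMP 98 (1985) 17–51 [Balaban1985Averaging] (Props. 1–2 p.26).
-/

set_option autoImplicit false

noncomputable section

namespace Summit.QuantumFields.YangMills.Theorems

open Set
open Literature.MathematicalPhysics.QuantumFieldTheory.Balaban1983to89
open Literature.MathematicalPhysics.QuantumFieldTheory.Balaban1983to89.ExpMeanLog (deltaSU)
open Literature.MathematicalPhysics.QuantumFieldTheory.Balaban1983to89.T3ContinuumYM3Torus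
open Literature.MathematicalPhysics.QuantumFieldTheory.Balaban1983to89.B10Eq42TorusConstraint (lam42)
open Literature.MathematicalPhysics.QuantumFieldTheory.Balaban1985CMP102.Setting
open Summit.QuantumFields.Balaban3D.Carriers
open Summit.QuantumFields.Balaban3D.Proofs.Primitives (AlphaConsts)
open Summit.QuantumFields.YangMills.Theorems.BalabanUVNodesN08AlphaCompactSel (regClassC)
open Summit.QuantumFields.YangMills.Theorems.BalabanUVNodesN08AlphaHistGeom (distTo)

section T3

variable (F : T3Family) (𝔠 : AlphaConsts F.L (suGroupModel 2).N) (γ : ℝ) (hγ : 0 < γ) (hγ1 : γ ≤ (min 𝔠.gamma0 1) ^ 2)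

/-- **THE DISPLAYED KINEMATIC ROW «REGULAR, (67)-LARGE PROFILE WITH SMALL FINE PLAQUETTES NEAR THE READ REGIONS»** (hypothesis schema, never asserted; the fork's
target): for every `k ≤ K` and admissible non-trivial `h` there is `U ∈ regClassC 𝔊 𝔠 k h ∩ large67Set k h` and an `α₀` in [B7] Prop. 2's window at `d = 3`, `N = 2` such
that every fine plaquette with base point within `ℓ¹`-distance `39·L^{i₀}` of `lam42 Ω(h) k i` (`i₀ ≤ i ≤ k`) is `α₀·(L^{i₀})⁻²`-small.
[cite: Balaban1985UV3, (67)–(68) p.273; Balaban1985Averaging, Prop. 2 (52) p.26] -/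
def AlphaInputsT3AC.RegularProfileNearT3 (K : ℕ) : Prop :=
  ∀ (k : ℕ), k ≤ K → ∀ (h : Hist (F.P K) k),
    Hist.Admissible 𝔠.lane.carrier.M₁ (rcolOf (T3Scales F γ hγ (hγ1.trans (sq_min_one_le _ 𝔠.gamma0_pos)) K) 𝔠.lane.carrier) k h →
    h ≠ Hist.triv (F.P K) k →
    ∃ U : GaugeField (F.P K) 0 (Matrix.specialUnitaryGroup (Fin 2) ℂ),
      U ∈ regClassC (S := T3Scales F γ hγ (hγ1.trans (sq_min_one_le _ 𝔠.gamma0_pos)) K) (suGroupModel 2) 𝔠 k h ∧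
      U ∈ AlphaInputsT3AC.large67Set F 𝔠 γ hγ hγ1 K k h ∧
      ∃ α₀ : ℝ, 0 < α₀ ∧ (143 * ((((3 + 4 : ℕ) : ℝ)) ^ 2 / 4) ^ 2) * α₀ ≤ 1 / 3 ∧
        2 * α₀ ≤ 2 * deltaSU (Fin 2) / (((3 + 4) * F.L : ℕ) : ℝ) ^ 2 ∧
        ((((3 + 2) * F.L : ℕ) : ℝ) ^ 2 / 4) * (α₀ + 2 * (143 * ((((3 + 4 : ℕ) : ℝ)) ^ 2 / 4) ^ 2) * α₀ ^ 2) ≤ deltaSU (Fin 2) / 2 ∧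
        ∀ i₀ i : ℕ, i₀ ≤ i → i ≤ k → ∀ q : Plaq (F.P K) 0,
          distTo (S := T3Scales F γ hγ (hγ1.trans (sq_min_one_le _ 𝔠.gamma0_pos)) K)
              (lam42 (Omega 𝔠.lane.carrier.M₁ (rcolOf (T3Scales F γ hγ (hγ1.trans (sq_min_one_le _ 𝔠.gamma0_pos)) K) 𝔠.lane.carrier) k h) k i) q.src ≤
            39 * F.L ^ i₀ →
          dist1 (GaugeField.plaqHol U q) < α₀ * (((F.L : ℝ) ^ i₀)⁻¹) ^ 2

variable {F 𝔠 γ hγ hγ1} {K : ℕ}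

/-- **THE W-INDEPENDENT CORE OF `𝒞_L` IS NON-EMPTY UNDER THE PROFILE ROW** (`k ≤ K`, `h` admissible non-trivial): the profile lies in `localSmallT3 k h`
(`localSmallT3_of_plaqSmall_near_reads`) and in the two fine-field classes. [cite: Balaban1985UV3, (67)–(68) p.273] -/
theorem AlphaInputsT3AC.core_nonempty_of_regularProfileNear (hP : AlphaInputsT3AC.RegularProfileNearT3 F 𝔠 γ hγ hγ1 K) {k : ℕ} (hk : k ≤ K) {h : Hist (F.P K) k}
    (hh : Hist.Admissible 𝔠.lane.carrier.M₁ (rcolOf (T3Scales F γ hγ (hγ1.trans (sq_min_one_le _ 𝔠.gamma0_pos)) K) 𝔠.lane.carrier) k h)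
    (ht : h ≠ Hist.triv (F.P K) k) :
    (AlphaInputsT3AC.localSmallT3 F 𝔠 γ hγ hγ1 K k h ∩
      (regClassC (S := T3Scales F γ hγ (hγ1.trans (sq_min_one_le _ 𝔠.gamma0_pos)) K) (suGroupModel 2) 𝔠 k h ∩
        AlphaInputsT3AC.large67Set F 𝔠 γ hγ hγ1 K k h)).Nonempty := by
  obtain ⟨U, hreg, hL, α₀, hα, hα3, hα2, hδ, hU⟩ := hP k hk h hh ht
  exact ⟨U, AlphaInputsT3AC.localSmallT3_of_plaqSmall_near_reads (𝔠 := 𝔠) (hγ1 := hγ1) hk h hα hα3 hα2 hδ hU, hreg, hL⟩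

/-- **★ THE UNCHARGED HALF OF (D6L) FROM THE PROFILE ROW**: for an UNCHARGED datum `W` the localised adapted class `𝒞_L(k, h, W)` is its W-independent core (the guarded
(42)/r3 clause is vacuous), hence non-empty. [cite: Balaban1985UV3, (42) p.266 + (67)–(68) p.273] -/
theorem AlphaInputsT3AC.adaptedClassT3L_nonempty_of_not_charged (hP : AlphaInputsT3AC.RegularProfileNearT3 F 𝔠 γ hγ hγ1 K) {k : ℕ} (hk : k ≤ K) {h : Hist (F.P K) k}
    (hh : Hist.Admissible 𝔠.lane.carrier.M₁ (rcolOf (T3Scales F γ hγ (hγ1.trans (sq_min_one_le _ 𝔠.gamma0_pos)) K) 𝔠.lane.carrier) k h)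
    (ht : h ≠ Hist.triv (F.P K) k) (W : GaugeField (F.P K) k (Matrix.specialUnitaryGroup (Fin 2) ℂ))
    (hW : ¬ ChargedT3 F γ 𝔠.b₀ 𝔠.p₀ (avgWindowFactor F.L) K 𝔠.lane.carrier.M₁
      (rcolOf (T3Scales F γ hγ (hγ1.trans (sq_min_one_le _ 𝔠.gamma0_pos)) K) 𝔠.lane.carrier) k h W) :
    (AlphaInputsT3AC.adaptedClassT3L F 𝔠 γ hγ hγ1 K k h W).Nonempty := by
  obtain ⟨U, hloc, hreg, hL⟩ := AlphaInputsT3AC.core_nonempty_of_regularProfileNear hP hk hh ht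
  exact ⟨U, hloc, hreg, hL, fun hc => absurd hc hW⟩

end T3

end Summit.QuantumFields.YangMills.Theorems

end
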